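import Summits.Ventures.PercRepro.SixFourResidueThreeTwoPointsA
import Summits.Ventures.PercRepro.SixFourResidueThreeSmall

/-!
# The `t = 3` clause of `SixFourResidue` — plane + two points (Theorem 21.6 at `t = 3`), part B: counts and `g ≤ 8`

The counts of part A's regrouped sum in profile form (`share3C_sum_ge`, `dem2_sum_le` + `card_dem2_le_Dem2Prof`,
`dem3_sum_le` + `card_small_le_SmallProf`, `beta_sum_ge` with `#{|L′| = 2} ≤ C(p, 2)` and
`#{L′ ∈ R₂(τ) : |L′| ≥ 3} ≤ Σ_m inc_m·ε(m)`), the profile inequality of Theorem 21.6 at `t = 3` (scaled by `20`)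
`48·Dem₂ + 24·Small + 12·C(p,2) + 4·Col ≤ 39·T + 120·D₃ − 50·LP` decided on the admissible pairwise-OK profiles with
`p ≤ 6` (`profCheck3b_holds`; at `p = 7` the crude `Small` bound fails on the `6`-line + point profile, so this file stops
at `g ≤ 8`; exact `Δ₃(τ)` minima over all linear spaces: `279/20, 93/5, 57/2, 1017/20` for `P = 4, …, 7`), and
`J_three_nonneg_of_plane_add_two : (P₀ ∩ G).card + 2 = G.card → G.card ≤ 8 → 0 ≤ J M G 3` (when `τ` has rank `≤ 2`
every rank-`4` subset is demand-free).
-/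

namespace PercRepro.SixFour

/-! ## The profile side -/

/-- `#{B″ ∈ R₃(τ) : |B″| ≤ p − 2}` for `p ≤ 6`: the triples when `p ≥ 5` and the rank-`3` `4`-sets when `p ≥ 6`. -/
def Dem2Prof (p i3 i4 i5 i6 : ℕ) : ℤ :=
  (if 5 ≤ p then TProf p i3 i4 i5 i6 else 0) + (if 6 ≤ p then (r34Prof p i4 i5 i6 : ℤ) else 0)

/-- `Col = Σ_m inc_m·ε(m)`: the collinear subsets with `≥ 3` points. -/
def ColProf (i3 i4 i5 i6 : ℕ) : ℤ := i3 * 1 + i4 * 5 + i5 * 16 + i6 * 42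

/-- The profile inequality of Theorem 21.6 at `t = 3` (scaled by `20`). -/
def ProfIneq3b (p i3 i4 i5 i6 : ℕ) : Prop :=
  48 * Dem2Prof p i3 i4 i5 i6 + 24 * SmallProf p i3 i4 i5 i6 + 12 * (p.choose 2 : ℤ) + 4 * ColProf i3 i4 i5 i6 ≤
    39 * TProf p i3 i4 i5 i6 + 120 * (D3Prof p i4 i5 i6 : ℤ) - 50 * LPProf p i3 i4 i5 i6

/-- `ProfIneq3b` is decidable. -/
instance (p i3 i4 i5 i6 : ℕ) : Decidable (ProfIneq3b p i3 i4 i5 i6) := by unfold ProfIneq3b; infer_instance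

/-- The finite check: every admissible, pairwise-OK profile with `p ≤ 6` satisfies the inequality. -/
def profCheck3b : Prop := ∀ p < 7, ∀ i3 < 8, ∀ i4 < 4, ∀ i5 < 3, ∀ i6 < 2,
  (!decide (ProfileOK p (p.choose 2 - (3 * i3 + 6 * i4 + 10 * i5 + 15 * i6)) i3 i4 i5 i6 ∧ PairOK p i3 i4 i5 i6) ||
    decide (ProfIneq3b p i3 i4 i5 i6)) = true

/-- The finite check holds. -/
theorem profCheck3b_holds : profCheck3b := by
  unfold profCheck3b
  decide

/-- **The `t = 3`, `k = 2` profile inequality** for every admissible, pairwise-OK profile with `p ≤ 6`. -/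
theorem profIneq3b_of_profileOK {p i2 i3 i4 i5 i6 : ℕ} (hp : p ≤ 6) (h3 : i3 < 8) (h4 : i4 < 4) (h5 : i5 < 3)
    (h6 : i6 < 2) (hok : ProfileOK p i2 i3 i4 i5 i6) (hpair : PairOK p i3 i4 i5 i6) : ProfIneq3b p i3 i4 i5 i6 := by
  have hi2 : i2 = p.choose 2 - (3 * i3 + 6 * i4 + 10 * i5 + 15 * i6) := by
    have := hok.1
    omega
  subst hi2
  have h := profCheck3b_holds p (by omega) i3 h3 i4 h4 i5 h5 i6 h6
  rw [Bool.or_eq_true, Bool.not_eq_true', decide_eq_false_iff_not, decide_eq_true_eq] at h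
  exact h.resolve_left (not_not.2 ⟨hok, hpair⟩)

/-! ## The counts -/

open Finset ThmH

variable {α : Type*} [DecidableEq α] {M : Matroid α} [M.Finite] {G : Finset α}

section Counts

variable (hs : Simple M) {τ : Finset α} (hτ : τ ⊆ gr M)
include hs hτ

omit hs hτ in
/-- A triple has share `39/20`. -/
theorem share3C_eq_of_card_three {S : Finset α} (hc : S.card = 3) : share3C M S = 39 / 20 := by
  unfold share3C
  rw [kcol_eq_three_of_card_three hc]
  norm_num

/-- A rank-`3` set with `≥ 4` points has share `≥ 7/2`, and `≥ 6` unless it is a line plus a point. -/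
theorem share3C_ge_of_four_le {S : Finset α} (hS : S ⊆ τ) (hr3 : M.eRk (S : Set α) = 3) (hc : 4 ≤ S.card) :
    (if kcol M S = 1 then (7 / 2 : ℚ) else 6) ≤ share3C M S := by
  have hk := kcol_le_one_of_four_le hs hτ hS hr3 hc
  unfold share3C
  split_ifs with h1
  · rw [h1]; norm_num
  · have h0 : kcol M S = 0 := by omega
    rw [h0]; norm_num

/-- **The share sum**: `(39/20)·T + 6·D₃ − (5/2)·LP ≤ Σ_{S ∈ R₃(τ)} c₃(S)`. -/
theorem share3C_sum_ge :
    (39 / 20 : ℚ) * Tcnt M τ + 6 * D3cnt M τ - 5 / 2 * LPcnt M τ ≤ ∑ S ∈ R3 M τ, share3C M S := by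
  have hpt : ∀ S ∈ R3 M τ, (if S.card = 3 then (39 / 20 : ℚ) else if 4 ≤ S.card ∧ kcol M S = 1 then 7 / 2 else 6)
      ≤ share3C M S := by
    intro S hS
    obtain ⟨hSτ, hr3⟩ := mem_R3.1 hS
    have h3 : 3 ≤ S.card := three_le_card_of_eRk_eq_three hr3
    split_ifs with hc h41
    · exact (share3C_eq_of_card_three hc).ge
    · have := share3C_ge_of_four_le hs hτ hSτ hr3 h41.1
      rw [if_pos h41.2] at this
      exact this
    · have := share3C_ge_of_four_le hs hτ hSτ hr3 (by omega)
      rw [if_neg (fun h => h41 ⟨by omega, h⟩)] at this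
      exact this
  refine le_trans ?_ (Finset.sum_le_sum hpt)
  rw [Finset.sum_ite, Finset.sum_const, Finset.sum_ite, Finset.sum_const, Finset.sum_const, nsmul_eq_mul, nsmul_eq_mul,
    nsmul_eq_mul]
  unfold Tcnt D3cnt LPcnt
  have hA : ((R3 M τ).filter (fun S => ¬ S.card = 3)).filter (fun S => 4 ≤ S.card ∧ kcol M S = 1) =
      (R3 M τ).filter (fun S => 4 ≤ S.card ∧ kcol M S = 1) := by
    rw [Finset.filter_filter]
    refine Finset.filter_congr (fun S hS => ?_)
    constructor
    · exact fun h => h.2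
    · exact fun h => ⟨by omega, h⟩
  have hB : ((R3 M τ).filter (fun S => ¬ S.card = 3)).filter (fun S => ¬ (4 ≤ S.card ∧ kcol M S = 1)) =
      ((R3 M τ).filter (fun S => 4 ≤ S.card)).filter (fun S => ¬ (kcol M S = 1)) := by
    rw [Finset.filter_filter, Finset.filter_filter]
    refine Finset.filter_congr (fun S hS => ?_)
    have h3 : 3 ≤ S.card := three_le_card_of_eRk_eq_three (mem_R3.1 hS).2
    constructor
    · rintro ⟨hne, hn⟩
      refine ⟨by omega, fun h1 => hn ⟨by omega, h1⟩⟩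
    · rintro ⟨h4, hn⟩
      exact ⟨by omega, fun h => hn h.2⟩
  rw [hA, hB]
  have hsplit := Finset.card_filter_add_card_filter_not (s := (R3 M τ).filter (fun S => 4 ≤ S.card))
    (fun S : Finset α => kcol M S = 1)
  rw [Finset.filter_filter] at hsplit
  have hsplit' : ((R3 M τ).filter (fun S => 4 ≤ S.card ∧ kcol M S = 1)).card +
      (((R3 M τ).filter (fun S => 4 ≤ S.card)).filter (fun S => ¬ kcol M S = 1)).card =
      ((R3 M τ).filter (fun S => 4 ≤ S.card)).card := by
    rw [← hsplit, Finset.filter_filter]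
  have hq : ((((R3 M τ).filter (fun S => 4 ≤ S.card)).filter (fun S => ¬ kcol M S = 1)).card : ℚ) =
      ((R3 M τ).filter (fun S => 4 ≤ S.card)).card - ((R3 M τ).filter (fun S => 4 ≤ S.card ∧ kcol M S = 1)).card := by
    rw [← hsplit']
    push_cast
    ring
  rw [hq]
  ring_nf
  linarith

omit hs hτ in
/-- **The `dem₂` count**: `Σ_{S ∈ R₃(τ)} dem₂(S) ≤ #{S ∈ R₃(τ) : |S| + 2 ≤ p}` (a rest of `≤ 1` point has rank `≤ 1`). -/
theorem dem2_sum_le :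
    ∑ S ∈ R3 M τ, dem2 M τ S ≤ ((R3 M τ).filter (fun S => S.card + 2 ≤ τ.card)).card := by
  have hpt : ∀ S ∈ R3 M τ, dem2 M τ S ≤ (if S.card + 2 ≤ τ.card then (1 : ℚ) else 0) := by
    intro S hS
    obtain ⟨hSτ, -⟩ := mem_R3.1 hS
    unfold dem2
    split_ifs with h1 h2 h2
    · norm_num
    · norm_num
    · norm_num
    · exfalso
      apply h1
      have hle := M.eRk_le_encard ((τ \ S : Finset α) : Set α)
      rw [Set.encard_coe_eq_coe_finsetCard, Finset.card_sdiff_of_subset hSτ] at hle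
      have hc : τ.card - S.card ≤ 1 := by omega
      calc M.eRk ((τ \ S : Finset α) : Set α) + 2 ≤ ((τ.card - S.card : ℕ) : ℕ∞) + 2 := add_le_add_left hle 2
        _ ≤ ((1 : ℕ) : ℕ∞) + 2 := add_le_add_left (by exact_mod_cast hc) 2
        _ = 3 := by norm_num
  refine (Finset.sum_le_sum hpt).trans ?_
  rw [Finset.sum_ite, Finset.sum_const, Finset.sum_const_zero, add_zero, nsmul_eq_mul, mul_one]

/-- **The `dem₂`-demanded sets are small**: `#{S ∈ R₃(τ) : |S| + 2 ≤ p} ≤ Dem2Prof` for a rank-`3` trace with `p ≤ 6`. -/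
theorem card_dem2_le_Dem2Prof (hr3 : M.eRk (τ : Set α) = 3) (h6 : τ.card ≤ 6) :
    ((((R3 M τ).filter (fun S => S.card + 2 ≤ τ.card)).card : ℕ) : ℤ) ≤
      Dem2Prof τ.card (inc M τ 3) (inc M τ 4) (inc M τ 5) (inc M τ 6) := by
  have h7 : τ.card ≤ 7 := by omega
  unfold Dem2Prof
  rw [← Tcnt_eq hs hτ hr3 h7, ← card_four_eq hs hτ hr3 h7]
  have hsub : (R3 M τ).filter (fun S => S.card + 2 ≤ τ.card) ⊆
      ((R3 M τ).filter (fun S => S.card = 3 ∧ 5 ≤ τ.card)) ∪ ((R3 M τ).filter (fun S => S.card = 4 ∧ 6 ≤ τ.card)) := by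
    intro S hS
    rw [Finset.mem_filter] at hS
    rw [Finset.mem_union, Finset.mem_filter, Finset.mem_filter]
    have h3 : 3 ≤ S.card := three_le_card_of_eRk_eq_three (mem_R3.1 hS.1).2
    rcases (show S.card = 3 ∨ S.card = 4 by omega) with h | h
    · exact Or.inl ⟨hS.1, h, by omega⟩
    · exact Or.inr ⟨hS.1, h, by omega⟩
  have h1 : ((R3 M τ).filter (fun S => S.card = 3 ∧ 5 ≤ τ.card)).card = if 5 ≤ τ.card then Tcnt M τ else 0 := by
    split_ifs with h5
    · unfold Tcnt
      congr 1
      exact Finset.filter_congr (fun S _ => by simp [h5])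
    · rw [Finset.card_eq_zero, Finset.filter_eq_empty_iff]
      intro S _ h
      exact h5 h.2
  have h2 : ((R3 M τ).filter (fun S => S.card = 4 ∧ 6 ≤ τ.card)).card =
      if 6 ≤ τ.card then ((R3 M τ).filter (fun S => S.card = 4)).card else 0 := by
    split_ifs with h6'
    · congr 1
      exact Finset.filter_congr (fun S _ => by simp [h6'])
    · rw [Finset.card_eq_zero, Finset.filter_eq_empty_iff]
      intro S _ h
      exact h6' h.2
  have hle : ((R3 M τ).filter (fun S => S.card + 2 ≤ τ.card)).card ≤
      ((R3 M τ).filter (fun S => S.card = 3 ∧ 5 ≤ τ.card)).card +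
        ((R3 M τ).filter (fun S => S.card = 4 ∧ 6 ≤ τ.card)).card :=
    (Finset.card_le_card hsub).trans (Finset.card_union_le _ _)
  rw [h1, h2] at hle
  have hz := (Nat.cast_le (α := ℤ)).2 hle
  push_cast at hz
  split_ifs at hz ⊢ <;> linarith

omit [DecidableEq α] hs hτ in
/-- `#{L′ ∈ R₂(τ) : |L′| = 2} ≤ C(p, 2)`. -/
theorem card_R2_two_le : ((R2 M τ).filter (fun L => L.card = 2)).card ≤ τ.card.choose 2 := by
  rw [← Finset.card_powersetCard 2 τ]
  apply Finset.card_le_card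
  intro L hL
  rw [Finset.mem_filter] at hL
  rw [Finset.mem_powersetCard]
  exact ⟨(mem_R2.1 hL.1).1, hL.2⟩

omit hs in
/-- **`#{L′ ∈ R₂(τ) : |L′| ≥ 3} ≤ Σ_m inc_m·ε(m)`**: a collinear set with `≥ 3` points is a subset of the trace of its
closure line. -/
theorem card_R2_three_le (hr : M.eRk (τ : Set α) = 3) (h7 : τ.card ≤ 7) :
    ((((R2 M τ).filter (fun L => 3 ≤ L.card)).card : ℕ) : ℤ) ≤ ColProf (inc M τ 3) (inc M τ 4) (inc M τ 5) (inc M τ 6) := by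
  set T := (lines M).sigma (fun L => (L ∩ τ).powerset.filter (fun C : Finset α => 3 ≤ C.card)) with hT
  have hsurj : Set.SurjOn (fun q : Σ _ : Finset α, Finset α => q.2) (T : Set _)
      (((R2 M τ).filter (fun L => 3 ≤ L.card)) : Set (Finset α)) := by
    intro S hS
    rw [Finset.mem_coe, Finset.mem_filter] at hS
    obtain ⟨hS2, h3⟩ := hS
    obtain ⟨hSτ, hr2⟩ := mem_R2.1 hS2
    have hL := clF_mem_lines (hSτ.trans hτ) hr2
    refine ⟨⟨clF M S, S⟩, ?_, rfl⟩
    rw [Finset.mem_coe, hT, Finset.mem_sigma, Finset.mem_filter, Finset.mem_powerset]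
    exact ⟨hL.1, Finset.subset_inter hL.2 hSτ, h3⟩
  have hcard : ((R2 M τ).filter (fun L => 3 ≤ L.card)).card ≤ T.card := Finset.card_le_card_of_surjOn _ hsurj
  have hTcard : T.card = ∑ L ∈ lines M, eps (L ∩ τ).card := by
    rw [hT, Finset.card_sigma]
    refine Finset.sum_congr rfl (fun L _ => ?_)
    rw [card_powerset_filter_three_le]
  have e := sum_lines_eq_sum_inc (M := M) τ (fun n => eps n)
  rw [e, sum_inc_range_eight hr h7] at hTcard
  have hi7 : inc M τ 7 = 0 := inc_eq_zero_of_card_le hr (by omega)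
  have he : eps 0 = 0 ∧ eps 1 = 0 ∧ eps 2 = 0 ∧ eps 3 = 1 ∧ eps 4 = 5 ∧ eps 5 = 16 ∧ eps 6 = 42 := by decide
  obtain ⟨e0, e1, e2, e3, e4, e5, e6⟩ := he
  simp only [Finset.sum_range_succ, Finset.sum_range_zero, e0, e1, e2, e3, e4, e5, e6, hi7, mul_zero, zero_add,
    mul_one] at hTcard
  unfold ColProf
  rw [hTcard] at hcard
  have hz := (Nat.cast_le (α := ℤ)).2 hcard
  push_cast at hz ⊢
  linarith

omit hs in
/-- **The β-sum**: `−(3/5)·C(p, 2) − (1/5)·Col ≤ Σ_{L′ ∈ R₂(τ)} β(L′)`. -/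
theorem beta_sum_ge (hr : M.eRk (τ : Set α) = 3) (h7 : τ.card ≤ 7) :
    -(3 / 5 : ℚ) * (τ.card.choose 2 : ℚ) - 1 / 5 * (ColProf (inc M τ 3) (inc M τ 4) (inc M τ 5) (inc M τ 6) : ℚ) ≤
      ∑ L ∈ R2 M τ, betaLB L := by
  have hsplit : ∑ L ∈ R2 M τ, betaLB L =
      ∑ L ∈ (R2 M τ).filter (fun L => L.card = 2), (-3 / 5 : ℚ) +
        ∑ L ∈ (R2 M τ).filter (fun L => ¬ L.card = 2), (-1 / 5 : ℚ) := by
    unfold betaLB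
    rw [Finset.sum_ite]
  rw [hsplit, Finset.sum_const, Finset.sum_const, nsmul_eq_mul, nsmul_eq_mul]
  have hA : (((R2 M τ).filter (fun L => L.card = 2)).card : ℚ) ≤ τ.card.choose 2 := by
    exact_mod_cast card_R2_two_le (M := M) (τ := τ)
  have hB : (((R2 M τ).filter (fun L => ¬ L.card = 2)).card : ℚ) ≤
      (ColProf (inc M τ 3) (inc M τ 4) (inc M τ 5) (inc M τ 6) : ℚ) := by
    have heq : (R2 M τ).filter (fun L => ¬ L.card = 2) = (R2 M τ).filter (fun L => 3 ≤ L.card) := by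
      refine Finset.filter_congr (fun L hL => ?_)
      have h2 : 2 ≤ L.card := by
        obtain ⟨-, hL2⟩ := mem_R2.1 hL
        by_contra h
        have hle := M.eRk_le_encard (L : Set α)
        rw [Set.encard_coe_eq_coe_finsetCard, hL2] at hle
        have : L.card ≤ 1 := by omega
        have h1 : ((L.card : ℕ) : ℕ∞) ≤ 1 := by exact_mod_cast this
        exact absurd (hle.trans h1) (by decide)
      omega
    rw [heq]
    exact_mod_cast card_R2_three_le hτ hr h7
  nlinarith

end Counts

/-! ## The `g ≤ 8` piece -/

section Final

variable (hs : Simple M) (hG : G ⊆ gr M) (hr : M.eRk (G : Set α) = 4) {P₀ : Finset α} (hP₀ : P₀ ∈ planes M)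
include hs hG hr hP₀

/-- **Theorem 21.6 at `t = 3`, `g ≤ 8` (§21.18.3 (β), `k = 2`)**: if some plane trace has `g − 2` points, `0 ≤ J₃(G)`. -/
theorem J_three_nonneg_of_plane_add_two (hcard : (P₀ ∩ G).card + 2 = G.card) (hg : G.card ≤ 8) : 0 ≤ J M G 3 := by
  obtain ⟨a, a', ht⟩ := twoOff_of_card (M := M) hcard
  have hτ : P₀ ∩ G ⊆ gr M := Finset.inter_subset_right.trans hG
  by_cases hr3 : M.eRk ((P₀ ∩ G : Finset α) : Set α) = 3
  · have hshares := J_three_ge_shares₂ ht hG hr hP₀ hs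
    set τ := P₀ ∩ G with hτdef
    have h6 : τ.card ≤ 6 := by omega
    have h7 : τ.card ≤ 7 := by omega
    have hsum := share3C_sum_ge hs hτ
    have hdem2 := dem2_sum_le (M := M) (τ := τ)
    have hdem2P := card_dem2_le_Dem2Prof hs hτ hr3 h6
    have hdem3 := dem3_sum_le (M := M) (τ := τ)
    have hsmall := card_small_le_SmallProf hs hτ hr3 h7
    have hbeta := beta_sum_ge hτ hr3 h7
    obtain ⟨hb3, hb4, hb5, hb6⟩ := inc_bounds_of_trace hs hτ h7
    have hok := profileOK_of_trace hs hτ hr3 h7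
    have hpair := pairOK_of_trace hs (τ := τ)
    have hineq := profIneq3b_of_profileOK h6 hb3 hb4 hb5 hb6 hok hpair
    unfold ProfIneq3b at hineq
    have hT := Tcnt_eq hs hτ hr3 h7
    have hD : ((D3cnt M τ : ℕ) : ℤ) = (D3Prof τ.card (inc M τ 4) (inc M τ 5) (inc M τ 6) : ℤ) := by
      exact_mod_cast D3cnt_eq hs hτ hr3 h7
    have hLP := LPcnt_le hs hτ hr3 h7
    have hZ : 48 * ((((R3 M τ).filter (fun S => S.card + 2 ≤ τ.card)).card : ℕ) : ℤ) +
        24 * ((((R3 M τ).filter (fun S => S.card + 3 ≤ τ.card)).card : ℕ) : ℤ) + 12 * (τ.card.choose 2 : ℤ) +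
        4 * ColProf (inc M τ 3) (inc M τ 4) (inc M τ 5) (inc M τ 6) ≤
        39 * (Tcnt M τ : ℤ) + 120 * (D3cnt M τ : ℤ) - 50 * (LPcnt M τ : ℤ) := by
      rw [hT, hD]
      linarith
    have hQ : (48 : ℚ) * (((R3 M τ).filter (fun S => S.card + 2 ≤ τ.card)).card : ℚ) +
        24 * (((R3 M τ).filter (fun S => S.card + 3 ≤ τ.card)).card : ℚ) + 12 * (τ.card.choose 2 : ℚ) +
        4 * (ColProf (inc M τ 3) (inc M τ 4) (inc M τ 5) (inc M τ 6) : ℚ) ≤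
        39 * (Tcnt M τ : ℚ) + 120 * (D3cnt M τ : ℚ) - 50 * (LPcnt M τ : ℚ) := by
      exact_mod_cast hZ
    have hsplit : ∑ B ∈ R3 M τ, (share3C M B - 12 / 5 * dem2 M τ B - 6 / 5 * dem3 M τ B) =
        ∑ B ∈ R3 M τ, share3C M B - 12 / 5 * ∑ B ∈ R3 M τ, dem2 M τ B - 6 / 5 * ∑ B ∈ R3 M τ, dem3 M τ B := by
      rw [Finset.sum_sub_distrib, Finset.sum_sub_distrib, Finset.mul_sum, Finset.mul_sum]
    rw [hsplit] at hshares
    linarith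
  · -- `τ` has rank `≤ 2`: every rank-`4` subset contains `a, a′`, its rest lies in `τ`, and the balance is demand-free
    have hle2 : M.eRk ((P₀ ∩ G : Finset α) : Set α) ≤ 2 := by
      have hle3 : M.eRk ((P₀ ∩ G : Finset α) : Set α) ≤ 3 := by
        rw [← (mem_planes.1 hP₀).2.2]
        exact M.eRk_mono (Finset.coe_subset.2 Finset.inter_subset_left)
      obtain ⟨n, hn, -⟩ := eRk_eq_nat M (P₀ ∩ G)
      rw [hn] at hle3 hr3 ⊢
      have a1 : n ≤ 3 := by exact_mod_cast hle3
      have a3 : n ≠ 3 := fun h => hr3 (by rw [h]; rfl)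
      exact_mod_cast (show n ≤ 2 by omega)
    apply J_three_nonneg_of_demandFree
    intro B hB
    obtain ⟨hBG, hB4⟩ := mem_R4.1 hB
    -- `a ∈ B` and `a′ ∈ B`: otherwise `B ⊆ τ ∪ {one point}` has rank `≤ 3`
    have haB : a ∈ B := by
      by_contra haB
      -- then `B ⊆ τ ∪ {a′}` has rank `≤ 3`
      have hBsub : B ⊆ insert a' (P₀ ∩ G) := by
        intro b hb
        rw [Finset.mem_insert]
        by_cases hbP : b ∈ P₀
        · exact Or.inr (Finset.mem_inter.2 ⟨hbP, hBG hb⟩)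
        · rcases ht.cover b (hBG hb) hbP with rfl | rfl
          · exact absurd hb haB
          · exact Or.inl rfl
      have h1 : M.eRk ((insert a' (P₀ ∩ G) : Finset α) : Set α) ≤ M.eRk ((P₀ ∩ G : Finset α) : Set α) + 1 := by
        rw [Finset.coe_insert]; exact M.eRk_insert_le_add_one _ _
      have : M.eRk (B : Set α) ≤ 3 := by
        calc M.eRk (B : Set α) ≤ M.eRk ((insert a' (P₀ ∩ G) : Finset α) : Set α) :=
              M.eRk_mono (Finset.coe_subset.2 hBsub)
          _ ≤ M.eRk ((P₀ ∩ G : Finset α) : Set α) + 1 := h1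
          _ ≤ 2 + 1 := add_le_add_left hle2 1
          _ = 3 := by norm_num
      rw [hB4] at this
      exact absurd this (by decide)
    have ha'B : a' ∈ B := by
      by_contra ha'B
      have hBsub : B ⊆ insert a (P₀ ∩ G) := by
        intro b hb
        rw [Finset.mem_insert]
        by_cases hbP : b ∈ P₀
        · exact Or.inr (Finset.mem_inter.2 ⟨hbP, hBG hb⟩)
        · rcases ht.cover b (hBG hb) hbP with rfl | rfl
          · exact Or.inl rfl
          · exact absurd hb ha'B
      have h1 : M.eRk ((insert a (P₀ ∩ G) : Finset α) : Set α) ≤ M.eRk ((P₀ ∩ G : Finset α) : Set α) + 1 := by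
        rw [Finset.coe_insert]; exact M.eRk_insert_le_add_one _ _
      have : M.eRk (B : Set α) ≤ 3 := by
        calc M.eRk (B : Set α) ≤ M.eRk ((insert a (P₀ ∩ G) : Finset α) : Set α) :=
              M.eRk_mono (Finset.coe_subset.2 hBsub)
          _ ≤ M.eRk ((P₀ ∩ G : Finset α) : Set α) + 1 := h1
          _ ≤ 2 + 1 := add_le_add_left hle2 1
          _ = 3 := by norm_num
      rw [hB4] at this
      exact absurd this (by decide)
    -- `G ∖ B ⊆ τ`
    have hsub : G \ B ⊆ P₀ ∩ G := by
      intro z hz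
      rw [Finset.mem_sdiff] at hz
      refine Finset.mem_inter.2 ⟨?_, hz.1⟩
      by_contra hzP
      rcases ht.cover z hz.1 hzP with rfl | rfl
      · exact hz.2 haB
      · exact hz.2 ha'B
    exact (M.eRk_mono (Finset.coe_subset.2 hsub)).trans hle2

end Final

end PercRepro.SixFour
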